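import Mathlib
import HarnessLib
import Summits.HubbardSuperconductivity.HubbardSuperconductivity.Theorems.KLProgrammeH10TwoPointLimitPerturbedCountKappa
import Summits.HubbardSuperconductivity.HubbardSuperconductivity.Theorems.KLProgrammeH10TwoPointLimitPerturbedCountPairsExists

/-!
# Route `KLProgramme` — crux K1 `H10TwoPointLimit` (stmt-HubbardSuperconductivity-19938):
# the FULLY EXPLICIT perturbation size `κ* = pcKappaStar B` and the uniform count on the moving curve with it

`pcKappaStar B = pcKappa B (pcTau B)` (`KLProgrammePerturbedCountConstantsDefs.lean`) is a closed-form function of the ten `BandBounds` fields.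
Here: the closed-form free constants `pcTau, pcLam, pcEta0 m₀, pcEta1` satisfy the lineage's four free smallness conditions with `A₂ ↦ pcAprime B`
(`free_conditions_explicit` — the recipe of `exists_small_constants_offset`, now with named witnesses); hence every `0 ≤ κ ≤ pcKappaStar B` is an
admissible perturbation size (`kappaStar_conditions`, via `perturbed_conditions_of_free`); and the uniform two-dimensional count on the moving curve
holds for EVERY `C²` even `δ` with `|δ|, ‖Dδ‖, ‖D²δ‖ ≤ min(pcKappaStar (bandBounds a b), η₀/2)` — an explicit threshold in the level range and the
margin, only the counting constant `K_p` remaining existential (`countPairs_perturbed_explicit`; risk r1 «explicit constants»: fs-1's sharp bundle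
`klfsSharpBandBounds` may replace `bandBounds` by the same proof). Everything is PROVED; no definitions.
References: BGM 2006 Lemma 3.1 / (2.76) / (2.80) / App. A2–A3 [cite: BenfattoGiulianiMastropietro2006]; HOME/prover-p4/PORT-NOTE.md §7.
-/

noncomputable section

namespace Summit.HubbardSuperconductivity.HubbardSuperconductivity.Theorems.PerturbedFermiCurve

set_option linter.dupNamespace false -- summit = problem name (single-conjunct summit), D-0017

open Real Set
open Literature.MathematicalPhysics.QuantumLattice Literature.MathematicalPhysics.QuantumLattice.BandSectorCounting
open Summit.HubbardSuperconductivity.HubbardSuperconductivity.Theorems.CountPairsOffset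

variable {a b : ℝ}

/-- `κ*(τ) ≤ Dt_min/2` (and `≤ 1`). [folklore] -/
theorem pcKappa_le (B : BandBounds a b) (τ : ℝ) : pcKappa B τ ≤ 1 ∧ pcKappa B τ ≤ B.Dtmin / 2 :=
  ⟨min_le_left _ _, (min_le_right _ _).trans (min_le_left _ _)⟩

/-- **The closed-form free constants satisfy the lineage's four free conditions with `A₂ ↦ A' = pcAprime B`** (the recipe of
`exists_small_constants_offset` with named witnesses `pcTau, pcLam, pcEta0 m₀, pcEta1`). [folklore] -/
theorem free_conditions_explicit (B : BandBounds a b) {m₀ : ℝ} (hm₀ : 0 < m₀) :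
    0 < pcTau B ∧ pcTau B < π ∧ 0 < pcLam B ∧ 0 < pcEta0 B m₀ ∧ pcEta0 B m₀ ≤ m₀ ∧ 0 < pcEta1 B ∧
      2 * (B.Cg * (pcLam B / 2 + 2 * B.smax * (pcEta0 B m₀ / B.Dtmin))) ≤ pcTau B ∧
      4 * pcAprime B * (pcEta0 B m₀ / B.Dtmin + B.smax * (B.Cg * (pcLam B + 2 * B.smax * (pcEta0 B m₀ / B.Dtmin)) + pcTau B)) ≤ B.hmin ∧
      2 * pcAprime B * (pcEta0 B m₀ / B.Dtmin + B.smax * (B.Cg * (pcLam B + pcAprime B * pcTau B + 2 * B.smax * (pcEta0 B m₀ / B.Dtmin)) +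
        pcTau B / 2)) ≤ B.hmin / 2 ∧
      (16 * B.smax ^ 2 + 8 * pcAprime B) * (pcEta0 B m₀ / B.Dtmin + B.smax * (B.Cg * (pcEta1 B / 4 + 2 * B.smax * (pcEta0 B m₀ / B.Dtmin)))) ≤
        2 * B.hmin := by
  have hA : 0 < pcAprime B := lt_max_of_lt_left B.A2_pos
  have hs := B.smax_pos; have hh := B.hmin_pos; have hCg := B.Cg_pos; have hDt := B.Dtmin_pos
  have hπ := Real.pi_pos
  set A := pcAprime B with hAdef
  set s := B.smax; set h := B.hmin; set Cg := B.Cg; set Dt := B.Dtmin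
  -- τ
  set τ := pcTau B with hτdef
  have hτeq : τ = min (1 / 2) (min (h / (16 * A * s * (1 + Cg * s ^ 2))) (h / (16 * A * s * (Cg * A + 1)))) := by rw [hτdef]; rfl
  have hτ0 : 0 < τ := by rw [hτeq]; exact lt_min (by norm_num) (lt_min (by positivity) (by positivity))
  have hτ1 : τ ≤ 1 / 2 := by rw [hτeq]; exact min_le_left _ _
  have hτa : τ ≤ h / (16 * A * s * (1 + Cg * s ^ 2)) := by rw [hτeq]; exact (min_le_right _ _).trans (min_le_left _ _)
  have hτb : τ ≤ h / (16 * A * s * (Cg * A + 1)) := by rw [hτeq]; exact (min_le_right _ _).trans (min_le_right _ _)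
  -- λ, η₁
  set lam := pcLam B with hlamdef
  have hlameq : lam = min (τ / (2 * Cg)) (h / (16 * A * s * Cg)) := by rw [hlamdef]; rfl
  have hlam0 : 0 < lam := by rw [hlameq]; exact lt_min (by positivity) (by positivity)
  have hlam1 : lam ≤ τ / (2 * Cg) := by rw [hlameq]; exact min_le_left _ _
  have hlam2 : lam ≤ h / (16 * A * s * Cg) := by rw [hlameq]; exact min_le_right _ _
  set η₁ := pcEta1 B with hη₁def
  have hη₁ : η₁ = 4 * h / ((16 * s ^ 2 + 8 * A) * s * Cg) := by rw [hη₁def]; rfl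
  have hη₁0 : 0 < η₁ := by rw [hη₁]; positivity
  -- η₀
  set η₀ := pcEta0 B m₀ with hη₀def
  have hη₀ : η₀ = min m₀ (min (τ * Dt / (8 * Cg * s)) (min (h * Dt / (16 * A * (1 + 2 * s ^ 2 * Cg)))
    (h * Dt / ((16 * s ^ 2 + 8 * A) * (1 + 2 * s ^ 2 * Cg))))) := by rw [hη₀def]; rfl
  have hη₀0 : 0 < η₀ := by rw [hη₀]; exact lt_min hm₀ (lt_min (by positivity) (lt_min (by positivity) (by positivity)))
  have hη₀m : η₀ ≤ m₀ := by rw [hη₀]; exact min_le_left _ _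
  have hη₀a : η₀ ≤ τ * Dt / (8 * Cg * s) := by rw [hη₀]; exact (min_le_right _ _).trans (min_le_left _ _)
  have hη₀b : η₀ ≤ h * Dt / (16 * A * (1 + 2 * s ^ 2 * Cg)) := by
    rw [hη₀]; exact (min_le_right _ _).trans ((min_le_right _ _).trans (min_le_left _ _))
  have hη₀c : η₀ ≤ h * Dt / ((16 * s ^ 2 + 8 * A) * (1 + 2 * s ^ 2 * Cg)) := by
    rw [hη₀]; exact (min_le_right _ _).trans ((min_le_right _ _).trans (min_le_right _ _))
  clear_value τ lam η₁ η₀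
  refine ⟨hτ0, by linarith [Real.pi_gt_three], hlam0, hη₀0, hη₀m, hη₁0, ?_, ?_, ?_, ?_⟩
  · -- covering
    have e1 : Cg * lam ≤ τ / 2 := by
      calc Cg * lam ≤ Cg * (τ / (2 * Cg)) := mul_le_mul_of_nonneg_left hlam1 hCg.le
        _ = τ / 2 := by field_simp
    have e2 : 4 * Cg * s * η₀ / Dt ≤ τ / 2 := by
      calc 4 * Cg * s * η₀ / Dt ≤ 4 * Cg * s * (τ * Dt / (8 * Cg * s)) / Dt := by gcongr
        _ = τ / 2 := by field_simp; ring
    have : 2 * (Cg * (lam / 2 + 2 * s * (η₀ / Dt))) = Cg * lam + 4 * Cg * s * η₀ / Dt := by ring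
    rw [this]; linarith
  · -- Cooper range, arbitrary offset
    have e1 : 4 * A * (1 + 2 * s ^ 2 * Cg) * η₀ / Dt ≤ h / 4 := by
      calc 4 * A * (1 + 2 * s ^ 2 * Cg) * η₀ / Dt ≤ 4 * A * (1 + 2 * s ^ 2 * Cg) * (h * Dt / (16 * A * (1 + 2 * s ^ 2 * Cg))) / Dt := by
            gcongr
        _ = h / 4 := by field_simp; ring
    have e2 : 4 * A * s * Cg * lam ≤ h / 4 := by
      calc 4 * A * s * Cg * lam ≤ 4 * A * s * Cg * (h / (16 * A * s * Cg)) := mul_le_mul_of_nonneg_left hlam2 (by positivity)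
        _ = h / 4 := by field_simp; ring
    have e3 : 4 * A * s * τ ≤ h / 4 := by
      calc 4 * A * s * τ ≤ 4 * A * s * (h / (16 * A * s * (1 + Cg * s ^ 2))) := mul_le_mul_of_nonneg_left hτa (by positivity)
        _ = h / (4 * (1 + Cg * s ^ 2)) := by field_simp; ring
        _ ≤ h / 4 := by
            apply div_le_div_of_nonneg_left hh.le (by norm_num)
            nlinarith [hCg, hs]
    have : 4 * A * (η₀ / Dt + s * (Cg * (lam + 2 * s * (η₀ / Dt)) + τ)) =
        4 * A * (1 + 2 * s ^ 2 * Cg) * η₀ / Dt + 4 * A * s * Cg * lam + 4 * A * s * τ := by ring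
    rw [this]; linarith
  · -- fold
    have e1 : 2 * A * (1 + 2 * s ^ 2 * Cg) * η₀ / Dt ≤ h / 8 := by
      calc 2 * A * (1 + 2 * s ^ 2 * Cg) * η₀ / Dt ≤ 2 * A * (1 + 2 * s ^ 2 * Cg) * (h * Dt / (16 * A * (1 + 2 * s ^ 2 * Cg))) / Dt := by
            gcongr
        _ = h / 8 := by field_simp; ring
    have e2 : 2 * A * s * Cg * lam ≤ h / 8 := by
      calc 2 * A * s * Cg * lam ≤ 2 * A * s * Cg * (h / (16 * A * s * Cg)) := mul_le_mul_of_nonneg_left hlam2 (by positivity)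
        _ = h / 8 := by field_simp; ring
    have e3 : A * s * (2 * Cg * A + 1) * τ ≤ h / 8 := by
      calc A * s * (2 * Cg * A + 1) * τ ≤ A * s * (2 * Cg * A + 1) * (h / (16 * A * s * (Cg * A + 1))) :=
            mul_le_mul_of_nonneg_left hτb (by positivity)
        _ = h * (2 * Cg * A + 1) / (16 * (Cg * A + 1)) := by field_simp
        _ ≤ h * (2 * (Cg * A + 1)) / (16 * (Cg * A + 1)) := by gcongr; linarith
        _ = h / 8 := by field_simp; ring
    have : 2 * A * (η₀ / Dt + s * (Cg * (lam + A * τ + 2 * s * (η₀ / Dt)) + τ / 2)) =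
        2 * A * (1 + 2 * s ^ 2 * Cg) * η₀ / Dt + 2 * A * s * Cg * lam + A * s * (2 * Cg * A + 1) * τ := by ring
    rw [this]; linarith
  · -- diagonal
    have e1 : (16 * s ^ 2 + 8 * A) * (1 + 2 * s ^ 2 * Cg) * η₀ / Dt ≤ h := by
      calc (16 * s ^ 2 + 8 * A) * (1 + 2 * s ^ 2 * Cg) * η₀ / Dt ≤
          (16 * s ^ 2 + 8 * A) * (1 + 2 * s ^ 2 * Cg) * (h * Dt / ((16 * s ^ 2 + 8 * A) * (1 + 2 * s ^ 2 * Cg))) / Dt := by gcongr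
        _ = h := by field_simp
    have e2 : (16 * s ^ 2 + 8 * A) * s * Cg * η₁ / 4 = h := by rw [hη₁]; field_simp
    have : (16 * s ^ 2 + 8 * A) * (η₀ / Dt + s * (Cg * (η₁ / 4 + 2 * s * (η₀ / Dt)))) =
        (16 * s ^ 2 + 8 * A) * (1 + 2 * s ^ 2 * Cg) * η₀ / Dt + (16 * s ^ 2 + 8 * A) * s * Cg * η₁ / 4 := by ring
    rw [this]; linarith




/-- **Every `0 ≤ κ ≤ pcKappaStar B` is an admissible perturbation size**: the five smallness conditions of `count_pairs_perturbed_exists` hold for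
`(pcTau B, pcLam B / 2, pcEta0 B m₀ / 2, pcEta1 B / 2)` and `κ₀ = κ₁ = κ₂ = κ`. [folklore] -/
theorem kappaStar_conditions (B : BandBounds a b) {m₀ : ℝ} (hm₀ : 0 < m₀) {κ : ℝ} (hκ0 : 0 ≤ κ) (hκ : κ ≤ pcKappaStar B) :
    2 * (B.Cg * pcE4 B κ κ (pcLam B / 2) (pcEta0 B m₀ / 2)) ≤ pcTau B ∧
      pcOdd B κ κ κ (2 * (pcLam B / 2)) (pcEta0 B m₀ / 2) (pcTau B) ≤ B.hmin / 2 ∧ κ * pcAE B κ κ ≤ B.hmin / 2 ∧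
      pcEven B κ κ κ (pcLam B / 2) (pcEta0 B m₀ / 2) (pcTau B) ≤ B.hmin / 2 ∧ pcDiag B κ κ κ (pcEta0 B m₀ / 2) (pcEta1 B / 2) ≤ 2 * B.hmin := by
  obtain ⟨hτ, -, hlam, hη₀, -, hη₁, c1, c2, c3, c4⟩ := free_conditions_explicit B hm₀
  exact perturbed_conditions_of_free B hτ hlam hη₀ hη₁ c1 c2 c3 c4 hκ0 hκ

/-- `0 < κ* = pcKappaStar B`. [folklore] -/
theorem pcKappaStar_pos (B : BandBounds a b) : 0 < pcKappaStar B :=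
  pcKappa_pos B (free_conditions_explicit B one_pos).1

/-- **The uniform sector count on the moving curve with the EXPLICIT perturbation threshold** `min(pcKappaStar (bandBounds a b), η₀/2)`:
for every level range `[a, b] ⊂ (-4, 0)`, margin `η₀` and tolerance constant `C_δ` there is `K_p` such that for EVERY `C²` even perturbation `δ` with
`|δ|, ‖Dδ‖, ‖D²δ‖ ≤ min(pcKappaStar (bandBounds a b), η₀/2)` on `ℝ²`, every interior `μ`, every root selection `u` of `{ε₀ + δ = μ}`, every offset `P`
and every isotropic grid (`N w = 2π`, `2^J w = π`, `w ≤ 1`, `C_δ w ≤ η₀/2`): `#{(i, j) : |h^E_P(θ_i, θ_j)| ≤ C_δ w} ≤ K_p (J + 2 + log N)/w`.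
[cite: BenfattoGiulianiMastropietro2006, Lemma 3.1 / (2.76) / (2.80) / App. A3] -/
theorem countPairs_perturbed_explicit :
    ∀ (a b : ℝ) (ha : -4 < a) (hab : a ≤ b) (hb : b < 0) (η₀ Cδ : ℝ), 0 < η₀ → 0 < Cδ →
      ∃ Kp : ℝ, 0 < Kp ∧
        ∀ δ : (Fin 2 → ℝ) → ℝ, ContDiff ℝ 2 δ → (∀ k, δ (-k) = δ k) →
          (∀ k : Fin 2 → ℝ, |δ k| ≤ min (pcKappaStar (bandBounds ha hab hb)) (η₀ / 2)) →
          (∀ k : Fin 2 → ℝ, ‖fderiv ℝ δ k‖ ≤ min (pcKappaStar (bandBounds ha hab hb)) (η₀ / 2)) →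
          (∀ k : Fin 2 → ℝ, ‖fderiv ℝ (fderiv ℝ δ) k‖ ≤ min (pcKappaStar (bandBounds ha hab hb)) (η₀ / 2)) →
        ∀ μ : ℝ, μ ∈ Set.Icc a b → a ≤ μ - η₀ → μ + η₀ ≤ b →
        ∀ u : ℝ → ℝ, (∀ θ, IsBandFermiRadius (μ - δ (u θ • dir θ)) θ (u θ)) →
        ∀ (P : ℝ × ℝ) (w : ℝ) (N Nh J : ℕ), 0 < w → w ≤ 1 → (N : ℝ) * w = 2 * Real.pi → (Nh : ℝ) * w = Real.pi → N = 2 * Nh →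
          (2 : ℝ) ^ J * w = Real.pi → Cδ * w ≤ η₀ / 2 →
          ((((Finset.range N ×ˢ Finset.range N).filter fun p : ℕ × ℕ =>
              |hfunE δ u μ P (w / 2 + p.1 * w) (w / 2 + p.2 * w)| ≤ Cδ * w).card : ℝ)) ≤ Kp * ((J : ℝ) + 2 + Real.log N) / w := by
  intro a b ha hab hb η₀ Cδ hη₀ hCδ
  set B := bandBounds ha hab hb with hBdef
  set κ := min (pcKappaStar B) (η₀ / 2) with hκdef
  have hκS := pcKappaStar_pos B
  have hκ0 : 0 < κ := lt_min hκS (by positivity)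
  have hκle : κ ≤ pcKappaStar B := min_le_left _ _
  have hκη : κ ≤ η₀ / 2 := min_le_right _ _
  obtain ⟨-, hκD'⟩ := pcKappa_le B (pcTau B)
  have hκD : κ < B.Dtmin := by
    have : pcKappaStar B ≤ B.Dtmin / 2 := hκD'
    linarith [B.Dtmin_pos]
  obtain ⟨hτ, hτπ, hlam, hη₀', hη₀'m, hη₁, -⟩ := free_conditions_explicit B (m₀ := η₀ / 2) (by positivity)
  obtain ⟨c1, c2, c3, c4, c5⟩ := kappaStar_conditions B (m₀ := η₀ / 2) (by positivity) hκ0.le hκle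
  obtain ⟨Kp, hKp, hcount⟩ := count_pairs_perturbed_exists B (κ₀ := κ) (κ₁ := κ) (κ₂ := κ) (Cδ := Cδ) (τ := pcTau B) (lam := pcLam B / 2)
    (η₀ := pcEta0 B (η₀ / 2) / 2) (η₁ := pcEta1 B / 2) hκ0.le hκD hκ0.le hCδ hτ hτπ (by linarith) (by linarith) (by linarith) c1 c2 c3 c4 c5
  have hπ := Real.pi_pos
  obtain ⟨K₁, hK₁⟩ : ∃ K₁ : ℝ, K₁ = (4 * π * Cδ / (pcEta0 B (η₀ / 2) / 2)) * (2 * π) := ⟨_, rfl⟩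
  have hK₁0 : 0 < K₁ := by rw [hK₁]; positivity
  refine ⟨Kp + K₁, by positivity, ?_⟩
  intro δ hδs heven hδ hκ' hκ₂ μ hμ hlo hhi u hu P w N Nh J hw hw1 hN hNh hNN hJ hδw
  have hN0 : (0 : ℝ) < N := by
    have : (0:ℝ) < N * w := by rw [hN]; positivity
    exact pos_of_mul_pos_left this hw.le
  have hNpos : 0 < N := Nat.pos_of_ne_zero (fun h0 => by rw [h0] at hN0; simp at hN0)
  have hN1 : (1 : ℝ) ≤ N := by exact_mod_cast hNpos
  have hlog : 0 ≤ Real.log N := Real.log_nonneg hN1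
  have hJ0 : (0 : ℝ) ≤ J := by positivity
  have hL1 : 1 ≤ (J : ℝ) + 2 + Real.log N := by linarith
  have hNw : (N : ℝ) = 2 * π / w := by field_simp; linarith only [hN]
  by_cases hsmallw : Cδ * w ≤ pcEta0 B (η₀ / 2) / 2 / 2
  · -- the main case: the two-dimensional count applies
    have hlo' : a ≤ μ - κ - pcEta0 B (η₀ / 2) / 2 := by linarith
    have hhi' : μ + κ + pcEta0 B (η₀ / 2) / 2 ≤ b := by linarith
    have h := hcount δ hδs heven hδ hκ' hκ₂ μ hlo' hhi' u hu P w N Nh J hw hw1 hN hNh hNN hJ hsmallw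
    have hK₁' : 0 ≤ K₁ * ((J : ℝ) + 2 + Real.log N) / w := by positivity
    have e : (Kp + K₁) * ((J : ℝ) + 2 + Real.log N) / w =
        Kp * ((J : ℝ) + 2 + Real.log N) / w + K₁ * ((J : ℝ) + 2 + Real.log N) / w := by ring
    rw [e]
    exact h.trans (le_add_of_nonneg_right hK₁')
  · -- coarse grids: the trivial bound `N² ≤ K₁/w`
    push Not at hsmallw
    have hη' : 0 < pcEta0 B (η₀ / 2) / 2 := by linarith
    have hcard : ((((Finset.range N ×ˢ Finset.range N).filter fun p : ℕ × ℕ =>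
        |hfunE δ u μ P (w / 2 + p.1 * w) (w / 2 + p.2 * w)| ≤ Cδ * w).card : ℝ)) ≤ (N : ℝ) * N := by
      have h1 := Finset.card_filter_le (Finset.range N ×ˢ Finset.range N) (fun p : ℕ × ℕ =>
        |hfunE δ u μ P (w / 2 + p.1 * w) (w / 2 + p.2 * w)| ≤ Cδ * w)
      rw [Finset.card_product, Finset.card_range] at h1
      exact_mod_cast h1
    have hNN' : (N : ℝ) * N ≤ K₁ / w := by
      have hN2 : (N : ℝ) ≤ 4 * π * Cδ / (pcEta0 B (η₀ / 2) / 2) := by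
        rw [hNw, div_le_div_iff₀ hw hη']
        nlinarith [hsmallw, hπ]
      calc (N : ℝ) * N ≤ (4 * π * Cδ / (pcEta0 B (η₀ / 2) / 2)) * (2 * π / w) := by
            rw [← hNw]; exact mul_le_mul_of_nonneg_right hN2 hN0.le
        _ = K₁ / w := by rw [hK₁]; ring
    have hKp' : 0 ≤ Kp * ((J : ℝ) + 2 + Real.log N) / w := by positivity
    calc _ ≤ (N : ℝ) * N := hcard
      _ ≤ K₁ / w := hNN'
      _ ≤ K₁ * ((J : ℝ) + 2 + Real.log N) / w := by
          apply div_le_div_of_nonneg_right _ hw.le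
          exact le_mul_of_one_le_right hK₁0.le hL1
      _ ≤ (Kp + K₁) * ((J : ℝ) + 2 + Real.log N) / w := by
          have e : (Kp + K₁) * ((J : ℝ) + 2 + Real.log N) / w =
              Kp * ((J : ℝ) + 2 + Real.log N) / w + K₁ * ((J : ℝ) + 2 + Real.log N) / w := by ring
          rw [e]; linarith

end Summit.HubbardSuperconductivity.HubbardSuperconductivity.Theorems.PerturbedFermiCurve

end
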